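import Summits.CriticalPhenomena.PercolationContinuityZ3.Theorems.Transplant.FKConnectivityAllQK5DisjFibers
import Summits.CriticalPhenomena.PercolationContinuityZ3.Theorems.Transplant.FKConnectivityAllQEdgeToggle
import Summits.CriticalPhenomena.PercolationContinuityZ3.Theorems.Transplant.FKConnectivityAllQK5CellsReflect
import Summits.CriticalPhenomena.PercolationContinuityZ3.Theorems.PercNearOneGluingNoHeavyLowerTailCubicFourPointL1CertGlue
import HarnessLib

/-!
# `K₅` is Potts–Rayleigh (`0 < q ≤ 1`), disjoint pairs — file 5: the BRIDGE from the random-cluster measure to the mask sums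

Helper file (`--supports stmt-CriticalPhenomena-4575`), FK sub-lane `prim-bschramm-fk-3` (gen 11) of the post-continuity programme;
builds on p205010 (kernel theorem, internal audit signed; external expert review pending).  No named facts, no sorries; standard axioms.

THE THEOREM OF THIS CHAIN (`…K5Disj`): **`K₅` is Potts–Rayleigh for every `0 < q ≤ 1`** — the random-cluster measure `φ_{w,q}` on every
weighted graph with at most five vertices is edge-negatively associated, `φ(J_e ∩ J_f) ≤ φ(J_e)φ(J_f)` for ALL pairs `e ≠ f` (adjacent pairs:
gen 10, `…K5`; this chain: the disjoint pairs, one `S₅`-orbit, `(e, f) = (01, 23)`).  Wagner 2008, Ex. 5.2 records Sokal's computation for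
`K₄`; for `K₅` the Rayleigh difference `Z¹⁰Z⁰¹ − Z⁰⁰Z¹¹` of `(01, 23)` has negative coefficients that no binomial (AM–GM) square repairs
(gen 10, LP scoping), so the certificate is a SUM OF GRAM SQUARES: with `y` the odds parameters of the eight pairs `E₈' = K₅ − {01, 23}`,
the reduced difference `D̂ = (Z¹⁰Z⁰¹ − Z⁰⁰Z¹¹)/(q²(1−q))` (degree `4` in `q`) is written in the scaled Bernstein basis
`Σ_{j ≤ 4} B̃_j(y) q^j (1−q)^{4−j}`, and each slice `B̃_j` is certified `≥ 0` on the orthant as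
`B̃_j = Σ_T y^T · m_Tᵀ H_{T,j} m_T + (nonnegative coefficients)`, `|T| ≤ 2`, `m_T` the multi-affine monomials off `T` inside the
Newton polytope, `H_{T,j} = U K Uᵀ` integer positive semidefinite (witness `s²K = LLᵀ + E`, `E` diagonally dominant).  The certificates
were found by semidefinite programming, facial reduction and integer rounding OUTSIDE Lean (bschramm/FK-BARRIER.md §15) and are CHECKED
HERE BY THE KERNEL (`decide +kernel`), fiber by fiber (`3^8 = 6561` fibers per slice).
[cite: Wagner2006, Ex. 5.2, Conj. 5.3, Thm. 5.8 (p. 13)] [cite: Grimmett2006, §3.9 eq. (3.94), Conj. (3.96) (pp. 63–66); §1.4 eq. (1.20) (p. 15)]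

THIS FILE: the listing `E₈'` as an `FK.RCEval` (gen 5), the kernel check of the packed table against `kB`/`reachB` (`table_spec`),
the three events of the bracket at a listed configuration as table bits (`0↮1`, `2↮3`, and `0↮1` after inserting `23`, via
`FourPointCert.openConn_insert_iff`), masses of `φ_{U,q}` for `U` supported in the listed pairs as mask sums
(`sum_rcWeightW_eq_sum_mask`), opening the pair `23` almost surely (`sum_rcWeightW_open_pair`, gen 6's toggle), the pair polynomial,
and **`bracket_eq`**: `q·(S_{U₁}(0↮1)Z_U − S_U(0↮1)Z_{U₁}) = −Σ_{m₁,m₂} vW(m₁)vW(m₂)·Σ_e pairCoef(m₁,m₂,e) q^e` (`U₁ = U[23 ↦ 1]`) —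
the left side is the bracket of fk-1's master identity `negCorr_defect_eq`.
-/

noncomputable section

namespace Summit.CriticalPhenomena.PercolationContinuityZ3.Theorems

namespace FK

namespace K5D

open Finset

open MeasureTheory Literature.Probability.LatticeModels Literature.Probability.Percolation
open Literature.Probability.Percolation.DecisionTree (ind ind_of_mem ind_of_not_mem)
open scoped Classical symmDiff

/-- the listing `E₈' = [02,03,04,12,13,14,24,34]` of the pairs of `K₅` other than `01, 23` -/
abbrev listing : RCEval := ⟨5, 8, ![0, 0, 0, 1, 1, 1, 2, 3], ![2, 3, 4, 2, 3, 4, 4, 4], fun _ => 0, 1⟩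

/-- the listing is valid (pairs distinct, parameters in `[0,1]`, `q > 0`). [folklore] -/
theorem listing_valid : listing.Valid := by decide +kernel

/-- every non-loop pair other than `01, 23` is listed -/
theorem exists_edge_eq : ∀ e : Sym2 (Fin 5), ¬ e.IsDiag → e ≠ s(0, 1) → e ≠ s(2, 3) → ∃ i : Fin 8, listing.edge i = e := by
  decide +kernel

set_option maxHeartbeats 0 in
/-- table = cluster counts and connection bits of the listed configurations (kernel check). -/
theorem table_spec_bool : ((List.range 256).all fun m =>
    (listing.kB (K5.ofMask m) == kOf m) && (listing.reachB (K5.ofMask m) 0 1 == tb m 0) &&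
    (listing.reachB (K5.ofMask m) 0 2 == tb m 1) && (listing.reachB (K5.ofMask m) 0 3 == tb m 2) &&
    (listing.reachB (K5.ofMask m) 1 2 == tb m 3) && (listing.reachB (K5.ofMask m) 1 3 == tb m 4) &&
    (listing.reachB (K5.ofMask m) 2 3 == tb m 5) && (K5.maskOf (K5.ofMask m) == m)) = true := by
  decide +kernel

/-- the packed table gives the cluster count and the six connection bits of every listed configuration. [cite: Grimmett2006, §1.2 eq. (1.1) (p. 4)] -/
theorem table_spec {m : ℕ} (hm : m < 256) :
    listing.kB (K5.ofMask m) = kOf m ∧ listing.reachB (K5.ofMask m) 0 1 = tb m 0 ∧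
    listing.reachB (K5.ofMask m) 0 2 = tb m 1 ∧ listing.reachB (K5.ofMask m) 0 3 = tb m 2 ∧
    listing.reachB (K5.ofMask m) 1 2 = tb m 3 ∧ listing.reachB (K5.ofMask m) 1 3 = tb m 4 ∧
    listing.reachB (K5.ofMask m) 2 3 = tb m 5 ∧ K5.maskOf (K5.ofMask m) = m := by
  have := (List.all_eq_true.1 table_spec_bool) m (List.mem_range.2 hm)
  simp only [Bool.and_eq_true, beq_iff_eq] at this
  obtain ⟨⟨⟨⟨⟨⟨⟨a, b⟩, c⟩, d⟩, e⟩, f⟩, g⟩, h⟩ := this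
  exact ⟨a, b, c, d, e, f, g, h⟩

/-- configuration of a mask -/
abbrev confM (m : ℕ) : BondConfig (Fin 5) := listing.conf (K5.ofMask m)

/-- `i ∈ ofMask m ↔` bit `i` of `m`. [folklore] -/
theorem mem_ofMask (m : ℕ) (i : Fin 8) : i ∈ K5.ofMask m ↔ m.testBit i = true := by
  unfold K5.ofMask; simp

/-- the six connection events at a mask are the table bits. [folklore] -/
theorem reach_iff_tb {m : ℕ} (hm : m < 256) :
    (confM m ∈ openConn (0 : Fin 5) 1 ↔ tb m 0 = true) ∧ (confM m ∈ openConn (0 : Fin 5) 2 ↔ tb m 1 = true) ∧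
    (confM m ∈ openConn (0 : Fin 5) 3 ↔ tb m 2 = true) ∧ (confM m ∈ openConn (1 : Fin 5) 2 ↔ tb m 3 = true) ∧
    (confM m ∈ openConn (1 : Fin 5) 3 ↔ tb m 4 = true) ∧ (confM m ∈ openConn (2 : Fin 5) 3 ↔ tb m 5 = true) := by
  obtain ⟨_, h01, h02, h03, h12, h13, h23, _⟩ := table_spec hm
  refine ⟨?_, ?_, ?_, ?_, ?_, ?_⟩ <;>
    rw [mem_openConn_iff', ← RCEval.reachB_iff] <;> simp only [h01, h02, h03, h12, h13, h23]

/-- the cluster count of a listed configuration is the table entry. [cite: Grimmett2006, §1.2 eq. (1.1) (p. 4)] -/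
theorem clusterCount_confM {m : ℕ} (hm : m < 256) : clusterCount (confM m) ∅ = kOf m := by
  rw [show confM m = listing.conf (K5.ofMask m) from rfl, RCEval.clusterCount_conf, (table_spec hm).1]

/-- `Bool` indicator as a real number -/
theorem ind_eq_bz_of_iff {A : Set (BondConfig (Fin 5))} {ω : BondConfig (Fin 5)} {b : Bool} (h : ω ∈ A ↔ b = true) :
    ind A ω = ((bz b : ℤ) : ℝ) := by
  cases b
  · rw [ind_of_not_mem (fun hA => by simpa using h.1 hA)]; simp [bz]
  · rw [ind_of_mem (h.2 rfl)]; simp [bz]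

/-- the three events at a mask: `0 ↮ 1`, `2 ↮ 3`, and `0 ↮ 1` after inserting `23` -/
theorem ind_X {m : ℕ} (hm : m < 256) : ind (openConn (0 : Fin 5) 1)ᶜ (confM m) = ((bz (!tb m 0) : ℤ) : ℝ) := by
  refine ind_eq_bz_of_iff ?_
  rw [Set.mem_compl_iff, (reach_iff_tb hm).1]; cases tb m 0 <;> simp
/-- `1{2 ↮ 3}` at a mask. [folklore] -/
theorem ind_V {m : ℕ} (hm : m < 256) : ind (openConn (2 : Fin 5) 3)ᶜ (confM m) = ((bz (!tb m 5) : ℤ) : ℝ) := by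
  refine ind_eq_bz_of_iff ?_
  rw [Set.mem_compl_iff, (reach_iff_tb hm).2.2.2.2.2]; cases tb m 5 <;> simp
/-- `1{0 ↮ 1}` after inserting the pair `23`, at a mask (`FourPointCert.openConn_insert_iff`). [folklore] -/
theorem ind_N {m : ℕ} (hm : m < 256) :
    ind (openConn (0 : Fin 5) 1)ᶜ (insert s((2 : Fin 5), 3) (confM m)) = ((bz (n1 m) : ℤ) : ℝ) := by
  refine ind_eq_bz_of_iff ?_
  obtain ⟨h01, h02, h03, h12, h13, _⟩ := reach_iff_tb hm
  rw [Set.mem_compl_iff, FourPointCert.openConn_insert_iff, openConn_comm (3 : Fin 5) 1, openConn_comm (2 : Fin 5) 1,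
    h01, h02, h03, h12, h13]
  unfold n1
  cases tb m 0 <;> cases tb m 1 <;> cases tb m 2 <;> cases tb m 3 <;> cases tb m 4 <;> simp

variable (U : Sym2 (Fin 5) → unitInterval)

/-- the parameter vector of a weight vector on the listed pairs -/
noncomputable def uOf : Fin 8 → ℝ := fun i => (U (listing.edge i) : ℝ)

/-- parameters are `≥ 0`. [folklore] -/
theorem uOf_nonneg (i : Fin 8) : 0 ≤ uOf U i := (U _).2.1
/-- parameters are `≤ 1`. [folklore] -/
theorem uOf_le_one (i : Fin 8) : uOf U i ≤ 1 := (U _).2.2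

/-- the product weight of a listed configuration -/
theorem weight_confM (hU : ∀ e, e ∉ Set.range listing.edge → (U e : ℝ) = 0) (m : ℕ) :
    BHK2006.weight (fun e => (U e : ℝ)) (confM m) = vW (uOf U) m := by
  unfold BHK2006.weight vW
  have hsub : Finset.univ.image listing.edge ⊆ (Finset.univ : Finset (Sym2 (Fin 5))) := Finset.subset_univ _
  rw [← Finset.prod_subset hsub]
  · rw [Finset.prod_image fun i _ j _ h => listing_valid.1 h]
    refine Finset.prod_congr rfl fun i _ => ?_
    have hmem : listing.edge i ∈ confM m ↔ m.testBit i = true := by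
      rw [show confM m = listing.conf (K5.ofMask m) from rfl, RCEval.edge_mem_conf listing_valid, mem_ofMask]
    by_cases h : m.testBit i = true
    · rw [if_pos (hmem.2 h), if_pos h]; rfl
    · rw [if_neg (fun h' => h (hmem.1 h')), if_neg h]; rfl
  · intro e _ he
    have he' : e ∉ Set.range listing.edge := by
      rintro ⟨i, rfl⟩; exact he (Finset.mem_image.2 ⟨i, Finset.mem_univ _, rfl⟩)
    dsimp only
    rw [if_neg (fun h => he' (RCEval.conf_subset_range _ h)), hU e he', sub_zero]

/-- **Masses as mask sums**: for a weight vector supported in the listed pairs,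
`Σ_ω w_q(ω) a(ω) = Σ_{m<256} vW(m) q^{k(m)} a(conf m)`. -/
theorem sum_rcWeightW_eq_sum_mask (hU : ∀ e, e ∉ Set.range listing.edge → (U e : ℝ) = 0) (q : ℝ)
    (a : BondConfig (Fin 5) → ℝ) :
    ∑ ω : BondConfig (Fin 5), rcWeightW U q ∅ ω * a ω =
      ∑ m ∈ Finset.range 256, vW (uOf U) m * q ^ kOf m * a (confM m) := by
  -- restrict to listed configurations
  have hsub : Finset.univ.image listing.conf ⊆ (Finset.univ : Finset (BondConfig (Fin 5))) := Finset.subset_univ _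
  rw [← Finset.sum_subset hsub]
  · rw [Finset.sum_image fun s _ t _ h => RCEval.conf_injective listing_valid h]
    -- reindex `t ↦ maskOf t`
    refine Finset.sum_nbij' K5.maskOf K5.ofMask (fun t _ => Finset.mem_range.2 (K5.maskOf_lt t))
      (fun m _ => Finset.mem_univ _) (fun t _ => K5.ofMask_maskOf t)
      (fun m hm => (table_spec (Finset.mem_range.1 hm)).2.2.2.2.2.2.2) ?_
    intro t _
    have hm : K5.maskOf t < 256 := K5.maskOf_lt t
    have ht : confM (K5.maskOf t) = listing.conf t := by
      show listing.conf (K5.ofMask (K5.maskOf t)) = listing.conf t; rw [K5.ofMask_maskOf]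
    rw [← ht]
    unfold rcWeightW
    rw [weight_confM U hU, clusterCount_confM hm]
  · intro ω _ hω
    have hω' : ¬ ω ⊆ Set.range listing.edge := by
      intro h
      obtain ⟨t, rfl⟩ := RCEval.exists_conf_eq_of_subset h
      exact hω (Finset.mem_image.2 ⟨t, Finset.mem_univ _, rfl⟩)
    obtain ⟨e, heω, he⟩ := Set.not_subset.1 hω'
    rw [rcWeightW_eq_zero_of_zero_mem U q ∅ (hU e he) heω, zero_mul]

/-- **Opening a pair almost surely** (`w f = 0`, `w₁ = w[f ↦ 1]` pointwise):
`Σ_ω w₁_q(ω) g(ω) = Σ_ω w_q(ω) (1 + (q⁻¹−1)·1{x↮y}(ω)) g(ω ∪ {f})`. -/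
theorem sum_rcWeightW_open_pair {V : Type*} [Fintype V] (w w₁ : Sym2 V → unitInterval) {q : ℝ} (hq : q ≠ 0) (x y : V)
    (hw : w s(x, y) = 0) (hw₁ : w₁ s(x, y) = 1) (hw₁' : ∀ e, e ≠ s(x, y) → w₁ e = w e) (g : BondConfig V → ℝ) :
    ∑ ω : BondConfig V, rcWeightW w₁ q ∅ ω * g ω =
      ∑ ω : BondConfig V, rcWeightW w q ∅ ω * ((1 + (q⁻¹ - 1) * ind (openConn x y : Set (BondConfig V))ᶜ ω) *
        g (insert s(x, y) ω)) := by
  have hw1 : w₁ = Function.update w s(x, y) 1 := by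
    funext e
    by_cases h : e = s(x, y)
    · rw [h, Function.update_self, hw₁]
    · rw [Function.update_of_ne h, hw₁' e h]
  have hw0 : Function.update w s(x, y) 0 = w := by
    rw [Function.update_eq_self_iff]; exact hw.symm
  subst hw1
  let σ : Equiv.Perm (BondConfig V) := Function.Involutive.toPerm (fun ω : BondConfig V => ω ∆ {s(x, y)})
    (symmDiff_left_involutive {s(x, y)})
  calc ∑ ω : BondConfig V, rcWeightW (Function.update w s(x, y) 1) q ∅ ω * g ω
      = ∑ ω : BondConfig V, rcWeightW (Function.update w s(x, y) 1) q ∅ (σ ω) * g (σ ω) :=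
        (Equiv.sum_comp σ (fun ω => rcWeightW (Function.update w s(x, y) 1) q ∅ ω * g ω)).symm
    _ = _ := by
        refine Finset.sum_congr rfl fun ω _ => ?_
        change rcWeightW (Function.update w s(x, y) 1) q ∅ (ω ∆ {s(x, y)}) * g (ω ∆ {s(x, y)}) = _
        by_cases he : s(x, y) ∈ ω
        · have hnot : s(x, y) ∉ ω ∆ {s(x, y)} := by simp [Set.mem_symmDiff, he]
          rw [rcWeightW_eq_zero_of_one_not_mem (Function.update w s(x, y) 1) q ∅ (by simp) hnot,
            rcWeightW_eq_zero_of_zero_mem w q ∅ (by rw [hw]; rfl) he]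
          ring
        · have hins : ω ∆ {s(x, y)} = insert s(x, y) ω := by
            ext f
            simp only [Set.mem_symmDiff, Set.mem_singleton_iff, Set.mem_insert_iff]
            constructor
            · rintro (⟨hf, -⟩ | ⟨rfl, -⟩)
              · exact Or.inr hf
              · exact Or.inl rfl
            · rintro (rfl | hf)
              · exact Or.inr ⟨rfl, he⟩
              · exact Or.inl ⟨hf, fun h => he (h ▸ hf)⟩
          rw [hins, rcWeightW_update_one_insert w hq he, hw0]
          ring

/-- the pair polynomial: `q^{k₁+k₂}·([0↮1]₁(q + (1−q)[2↮3]₂) − (q + (1−q)[2↮3]₁)[0↮1]⁺₁) = Σ_e pairCoef e q^e` -/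
theorem pairPoly_eq {m₁ m₂ : ℕ} (h₁ : m₁ < 256) (h₂ : m₂ < 256) (q : ℝ) :
    q ^ (kOf m₁ + kOf m₂) * (((bz (!tb m₁ 0) : ℤ) : ℝ) * (q + (1 - q) * ((bz (!tb m₂ 5) : ℤ) : ℝ)) -
      (q + (1 - q) * ((bz (!tb m₁ 5) : ℤ) : ℝ)) * ((bz (n1 m₁) : ℤ) : ℝ)) =
      ∑ e ∈ Finset.range 13, ((pairCoef m₁ m₂ e : ℤ) : ℝ) * q ^ e := by
  have k1 := kOf_le m₁ (List.mem_range.2 h₁)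
  have k2 := kOf_le m₂ (List.mem_range.2 h₂)
  set k := kOf m₁ + kOf m₂ with hk
  have hk10 : k ≤ 10 := by omega
  have hsum : ∑ e ∈ Finset.range 13, ((pairCoef m₁ m₂ e : ℤ) : ℝ) * q ^ e =
      ((pairA m₁ m₂ : ℤ) : ℝ) * q ^ k + ((pairB m₁ m₂ : ℤ) : ℝ) * q ^ (k + 1) := by
    have hterm : ∀ e ∈ Finset.range 13, ((pairCoef m₁ m₂ e : ℤ) : ℝ) * q ^ e =
        (if e = k then ((pairA m₁ m₂ : ℤ) : ℝ) * q ^ k else 0) + (if e = k + 1 then ((pairB m₁ m₂ : ℤ) : ℝ) * q ^ (k + 1) else 0) := by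
      intro e _
      unfold pairCoef
      rw [← hk, cond_beq_eq_ite, cond_beq_eq_ite]
      by_cases e1 : e = k
      · have e2 : ¬ e = k + 1 := by omega
        rw [if_pos e1, if_neg e2, if_pos e1, if_neg e2, e1]; push_cast; ring
      · by_cases e2 : e = k + 1
        · rw [if_neg e1, if_pos e2, if_neg e1, if_pos e2, e2]; push_cast; ring
        · rw [if_neg e1, if_neg e2, if_neg e1, if_neg e2]; push_cast; ring
    rw [Finset.sum_congr rfl hterm, Finset.sum_add_distrib, Finset.sum_ite_eq' , Finset.sum_ite_eq']
    rw [if_pos (Finset.mem_range.2 (by omega)), if_pos (Finset.mem_range.2 (by omega))]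
  rw [hsum]
  unfold pairA pairB
  cases tb m₁ 0 <;> cases tb m₁ 5 <;> cases tb m₂ 5 <;> cases n1 m₁ <;> simp [bz] <;> ring

variable {U}

/-- **The bracket identity**: with `f = 23` closed in `U`, `U₁ = U[f ↦ 1]`, and `U` supported in the listed pairs,
`q·(S_{U₁}(0↮1)·Z_U − S_U(0↮1)·Z_{U₁}) = −Σ_{m₂} Σ_{m₁} vW(m₁)vW(m₂)·Σ_e pairCoef(m₁,m₂,e) q^e`. -/
theorem bracket_eq (U₁ : Sym2 (Fin 5) → unitInterval) (hU : ∀ e, e ∉ Set.range listing.edge → (U e : ℝ) = 0)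
    (hUf : U s(2, 3) = 0) (hU₁ : U₁ s(2, 3) = 1) (hU₁' : ∀ e, e ≠ s(2, 3) → U₁ e = U e) {q : ℝ} (hq : q ≠ 0) :
    q * ((∑ ω : BondConfig (Fin 5), rcWeightW U₁ q ∅ ω * ind (openConn (0 : Fin 5) 1)ᶜ ω) * rcPartitionFunctionW U q ∅ -
      (∑ ω : BondConfig (Fin 5), rcWeightW U q ∅ ω * ind (openConn (0 : Fin 5) 1)ᶜ ω) * rcPartitionFunctionW U₁ q ∅) =
      -(∑ m₂ ∈ Finset.range 256, ∑ m₁ ∈ Finset.range 256, vW (uOf U) m₁ * vW (uOf U) m₂ *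
        ∑ e ∈ Finset.range 13, ((pairCoef m₁ m₂ e : ℤ) : ℝ) * q ^ e) := by
  -- the four masses as mask sums
  have hV : ∀ m ∈ Finset.range 256, ind (openConn (2 : Fin 5) 3)ᶜ (confM m) = ((bz (!tb m 5) : ℤ) : ℝ) :=
    fun m hm => ind_V (Finset.mem_range.1 hm)
  have hZ1 : rcPartitionFunctionW U₁ q ∅ =
      ∑ m ∈ Finset.range 256, vW (uOf U) m * q ^ kOf m * (1 + (q⁻¹ - 1) * (((bz (!tb m 5)) : ℤ) : ℝ)) := by
    have h1 := sum_rcWeightW_open_pair U U₁ hq (2 : Fin 5) 3 hUf hU₁ hU₁' (fun _ => (1 : ℝ))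
    have h2 := sum_rcWeightW_eq_sum_mask U hU q
      (fun ω => (1 + (q⁻¹ - 1) * ind (openConn (2 : Fin 5) 3 : Set (BondConfig (Fin 5)))ᶜ ω) * (1 : ℝ))
    unfold rcPartitionFunctionW
    simp only [mul_one] at h1 h2
    rw [h1, h2]
    exact Finset.sum_congr rfl fun m hm => by rw [hV m hm]
  have hS1 : (∑ ω : BondConfig (Fin 5), rcWeightW U₁ q ∅ ω * ind (openConn (0 : Fin 5) 1)ᶜ ω) =
      ∑ m ∈ Finset.range 256, vW (uOf U) m * q ^ kOf m *
        ((1 + (q⁻¹ - 1) * (((bz (!tb m 5)) : ℤ) : ℝ)) * (((bz (n1 m)) : ℤ) : ℝ)) := by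
    rw [sum_rcWeightW_open_pair U U₁ hq (2 : Fin 5) 3 hUf hU₁ hU₁', sum_rcWeightW_eq_sum_mask U hU]
    exact Finset.sum_congr rfl fun m hm => by rw [hV m hm, ind_N (Finset.mem_range.1 hm)]
  have hZ0 : rcPartitionFunctionW U q ∅ = ∑ m ∈ Finset.range 256, vW (uOf U) m * q ^ kOf m * 1 := by
    have h2 := sum_rcWeightW_eq_sum_mask U hU q (fun _ => (1 : ℝ))
    unfold rcPartitionFunctionW
    simp only [mul_one] at h2 ⊢
    exact h2
  have hS0 : (∑ ω : BondConfig (Fin 5), rcWeightW U q ∅ ω * ind (openConn (0 : Fin 5) 1)ᶜ ω) =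
      ∑ m ∈ Finset.range 256, vW (uOf U) m * q ^ kOf m * (((bz (!tb m 0)) : ℤ) : ℝ) := by
    rw [sum_rcWeightW_eq_sum_mask U hU]
    exact Finset.sum_congr rfl fun m hm => by rw [ind_X (Finset.mem_range.1 hm)]
  rw [hZ1, hS1, hZ0, hS0]
  -- expand the products of sums and compare termwise
  rw [Finset.sum_mul_sum, Finset.sum_mul_sum, ← Finset.sum_sub_distrib]
  conv_rhs => rw [Finset.sum_comm]
  rw [Finset.mul_sum, ← Finset.sum_neg_distrib]
  refine Finset.sum_congr rfl fun m₁ h₁ => ?_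
  rw [← Finset.sum_sub_distrib, Finset.mul_sum, ← Finset.sum_neg_distrib]
  refine Finset.sum_congr rfl fun m₂ h₂ => ?_
  rw [← pairPoly_eq (Finset.mem_range.1 h₁) (Finset.mem_range.1 h₂) q, pow_add]
  have hq1 : q * q⁻¹ = 1 := mul_inv_cancel₀ hq
  set a := vW (uOf U) m₁
  set b := vW (uOf U) m₂
  set X := (((bz (!tb m₁ 0)) : ℤ) : ℝ)
  set N := (((bz (n1 m₁)) : ℤ) : ℝ)
  set V1 := (((bz (!tb m₁ 5)) : ℤ) : ℝ)
  set V2 := (((bz (!tb m₂ 5)) : ℤ) : ℝ)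
  have e1 : q * (1 + (q⁻¹ - 1) * V1) = q + (1 - q) * V1 := by
    calc q * (1 + (q⁻¹ - 1) * V1) = q + (q * q⁻¹ - q) * V1 := by ring
      _ = q + (1 - q) * V1 := by rw [hq1]
  have e2 : q * (1 + (q⁻¹ - 1) * V2) = q + (1 - q) * V2 := by
    calc q * (1 + (q⁻¹ - 1) * V2) = q + (q * q⁻¹ - q) * V2 := by ring
      _ = q + (1 - q) * V2 := by rw [hq1]
  calc q * (a * q ^ kOf m₁ * ((1 + (q⁻¹ - 1) * V1) * N) * (b * q ^ kOf m₂ * 1) -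
        a * q ^ kOf m₁ * X * (b * q ^ kOf m₂ * (1 + (q⁻¹ - 1) * V2)))
      = a * b * (q ^ kOf m₁ * q ^ kOf m₂) * ((q * (1 + (q⁻¹ - 1) * V1)) * N - X * (q * (1 + (q⁻¹ - 1) * V2))) := by ring
    _ = a * b * (q ^ kOf m₁ * q ^ kOf m₂) * ((q + (1 - q) * V1) * N - X * (q + (1 - q) * V2)) := by rw [e1, e2]
    _ = -(a * b * (q ^ kOf m₁ * q ^ kOf m₂ * (X * (q + (1 - q) * V2) - (q + (1 - q) * V1) * N))) := by ring

end K5D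

end FK

end Summit.CriticalPhenomena.PercolationContinuityZ3.Theorems

end
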